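import Literature.MathematicalPhysics.QuantumFieldTheory.BalabanImbrieJaffe1984to88.BIJ88Ineq5144PairAdjustmentWitness

/-!
# `BalabanImbrieJaffe1984to88.BIJ88TripleActivity309` — T. Bałaban, J. Imbrie, A. Jaffe, *Effective action and cluster properties of the abelian
Higgs model*, Commun. Math. Phys. **114** (1988) 257–315 [BalabanImbrieJaffe1988], Sect. 5.13 p. 305–306 [PDF 49–50] and Sect. 5.14 (5.14.3) p. 309
[PDF 53]: **THE ACTIVITY OF A MULTI-CUBE POLYMER OF THE §5.13 MODEL AS A CORNER SUM OF REGION-LAW INTEGRALS, AND THE THREE-CUBE CHAIN DATUM** —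
the plumbing of `BIJ88Ineq5144TripleDecayWitness` (same seat and generation), split off to respect the 400-line bound.

statement-level skeleton of published theorems with citation tags; proofs where landed; nothing here is a claim about the Yang–Mills mass gap

PDF held: `paper:balaban1988-cmp114-bij-abelian-higgs-effective-action` (journal page = PDF page + 256).  p. 306, verbatim: *"Given some region X, a
union of □_i, we sum Γ over all subsets of {i ∈ I: □_i ⊂ X}, such that X is a single cluster. … ⟨·⟩_{s_Γ,X} is defined by integrating over the fields in
X only."*; p. 305, verbatim: *"□_iΔ_s□_{i′} = s_is_{i′}□_iΔ□_{i′}, i′ ≠ i, □_iΔ_s□_i = □_iΔ□_i"*; p. 307, verbatim: *"Each time some □_i's are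
joined, we have s-derivatives, which produce functional derivatives, chains of covariances C_ω(α), and factors ℱ = O(e^{−cr(e_k)}). … If the walk
ω(α) wanders through more than a few cubes, we begin to pickup factors e^{−cr(e_k)}. These control the sum over walks and partitions"*.

(v1.1 DOC-ONLY: the p. 307 quotation re-read on the x2 render — *"□_i's"* and *"factors ℱ = O(e^{−cr(e_k)})"* (script ℱ), correcting the text layer's «□_j's» / «δF»; owner r16 g23 zero-weight docfix; declarations byte-identical to v1 p349431.)

WHAT IS PROVED (unit `lit-balaban-p36`, generation 18 of the Phase-2 proof seat p36; SKELETON rows **C2.Eq5.14.3-5.14.4** / **C2.Eq5.13.3-5.13.4**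
member cells of `HOME/lit-balaban-r16/ROWS-C2-part2.md`, owner r16).  Data: the §5.13 model of this lineage (`BIJ88W6PrimeVsupp.actIn`).
* §1 `cornerSum_triple`; **`actIn_eq_cornerSum`** — for `|X″| ≥ 2` the prime-dropped located activity of `(H, X″)` for the data of `X` at `(Λ, t, γ)` is
  `[X″ connected]·Σ_{Λ′⊆X″}(−1)^{|X″∖Λ′|}∫Π dlaw_{1_{Λ′}}` (p25's `g1_of_two_le`: only `Γ = X″` makes `X″` a single cluster), `Π` = the product over the
  slots located in `X″` of their slot factors differentiated as `H` prescribes (gen 17's `actIn_pair_eq` is `|X″| = 2`).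
* §2 `integral_neg_mul_exp_neg_window` — `−K∫v ≤ ∫ −Kve^{−Kv} ≤ −e^{−K}K∫v` for a probability law, `0 < v ≤ 1`, `K > 0`.
* §3 the CHAIN datum on `Fin 3` (sites = cubes, `Δ = !![2,1,0;1,2,1;0,1,2]`: cube 0 couples to cube 1 and cube 1 to cube 2 only): `Δ ≻ 0`, `Δ ≥ ½·1`
  (`chain3_posDef_and_ge`); the corner forms `Δ_{1_{Λ′}}` in four coupling patterns (`interpForm_chain3_corners`); `⟨e^{−φ₀²}⟩_{1_{Λ′}} =
  √(det Δ_{1_{Λ′}}/det(Δ_{1_{Λ′}} + 2E₀₀))` (`integral_exp_neg_sq_regionLaw3`); the eight determinants (`chain3_dets`: site-0 variance `3/4` under the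
  full chain, `2/3` with bond 0–1 only, `1/2` otherwise — the cube TWO STEPS AWAY changes the decorated cube's marginal at second order in the
  couplings, by `O(1)`); numerical windows (`sqrt_windows3`).
HONEST SCOPE: identities and Gaussian bookkeeping only; no estimate of (5.14.4) is in this file.  0 `sorry`, 0 definitions, 0 `Prop` facts (D-0026);
imports `BIJ88Ineq5144PairAdjustmentWitness` (p36 g17: `integral_exp_neg_sq_div`; through it `BIJ88PairActivity309`); modifies nothing.  NOT summit
progress; NOT continuum; NOT Clay.  Cell `lit-balaban` Phase 2, seat p36 gen 18 (owner r16, referee ref-5).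
-/

noncomputable section

open Finset MeasureTheory Matrix ProbabilityTheory Filter
open Literature.MathematicalPhysics.QuantumFieldTheory.Balaban1983to89
open B2Eq228Conditioning (weight source)
open Literature.MathematicalPhysics.QuantumFieldTheory.BalabanImbrieJaffe1984to88
open BIJ88Sect2Statements (pLog)
open BIJ88Sect5Statements (CutoffProfile cutoff)
open BIJ88SlotMoments308 (slotFactor slotFactor_inr)
open BIJ88SlotMomentsGauss308 (fieldLaw integral_fieldLaw uD)
open BIJ88DirichletForms305 (interpForm interpForm_apply)
open BIJ88Clusters5134 (cornerSum act)
open BIJ88PolymerRep5134 (g1 g1_of_two_le IsConn corner corner_apply)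
open BIJ88PolymerRep5134Gauss (ext obs prec src zG)
open BIJ88Expansion5143 (g3 prime prime_of_not)
open BIJ88Expansion5143Gauss (fD)
open BIJ88Eq5145CornerModel (slotB slotY regionLaw zG_eq_integral_regionLaw prec_interp_corner prec_corner_posDef isProbabilityMeasure_regionLaw)
open BIJ88Eq5145CornerUrsell (cubeIn)
open BIJ88W6PrimeVsupp (actIn)
open BIJ88PairActivity309 (cornerSum_pair obs_fD_eq_prod_filter)
open BIJ88Ineq5144PairAdjustmentWitness (integral_exp_neg_sq_div)

namespace Literature.MathematicalPhysics.QuantumFieldTheory.BalabanImbrieJaffe1984to88.BIJ88TripleActivity309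

/-! ## §1 The activity of a multi-cube polymer as a corner sum of region-law integrals -/
section CornerSum
variable {I : Type*} [DecidableEq I] {R : Type*} [CommRing R]

/-- **the corner sum over a triple**: `Σ_{Λ′⊆{i,j,k}} (−1)^{|{i,j,k}∖Λ′|} F(Λ′) = F{i,j,k} − F{i,j} − F{i,k} − F{j,k} + F{i} + F{j} + F{k} − F∅`
(`i, j, k` distinct) — the `Γ = X` term of p. 306's `g₁(X)` for a three-cube `X` (`∫∫∫ds_ids_jds_k ∂³/∂s_i∂s_j∂s_k` in corner form).
[cite: BalabanImbrieJaffe1988, p.306 (Sect. 5.13); (5.13.3) p.305] -/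
theorem cornerSum_triple (F : Finset I → R) {i j k : I} (hij : i ≠ j) (hik : i ≠ k) (hjk : j ≠ k) :
    cornerSum F {i, j, k} = F {i, j, k} - F {i, j} - F {i, k} - F {j, k} + F {i} + F {j} + F {k} - F ∅ := by
  have hi : i ∉ ({j, k} : Finset I) := by simp [hij, hik]
  -- (Γ \ Λ).card for the eight subsets
  unfold cornerSum
  rw [sum_powerset_insert hi]
  have h1 : ∑ Λ ∈ ({j, k} : Finset I).powerset, (-1 : R) ^ (({i, j, k} : Finset I) \ Λ).card * F Λ =
      -(cornerSum F {j, k}) := by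
    unfold cornerSum
    rw [← neg_one_mul (∑ Λ ∈ _, _), mul_sum]
    refine sum_congr rfl fun Λ hΛ => ?_
    rw [mem_powerset] at hΛ
    have hiΛ : i ∉ Λ := fun h => hi (hΛ h)
    have : ({i, j, k} : Finset I) \ Λ = insert i (({j, k} : Finset I) \ Λ) := by
      rw [Finset.insert_sdiff_of_notMem _ hiΛ]
    rw [this, card_insert_of_notMem (by simp [hi]), pow_succ]
    ring
  have h2 : ∑ Λ ∈ ({j, k} : Finset I).powerset, (-1 : R) ^ (({i, j, k} : Finset I) \ insert i Λ).card * F (insert i Λ) =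
      F {i, j, k} - F {i, j} - F {i, k} + F {i} := by
    have hj : j ∉ ({k} : Finset I) := by simp [hjk]
    have hpk : ({k} : Finset I).powerset = {∅, {k}} := by ext s; simp [Finset.subset_singleton_iff]
    have hne : (∅ : Finset I) ≠ {k} := (singleton_ne_empty k).symm
    rw [sum_powerset_insert hj, hpk, sum_pair hne, sum_pair hne]
    simp only [Finset.insert_empty]
    have e1 : (({i, j, k} : Finset I) \ {i}).card = 2 := by
      rw [show (({i, j, k} : Finset I) \ {i}) = {j, k} by ext x; simp; constructor <;> intro h <;> aesop, card_pair hjk]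
    have e2 : (({i, j, k} : Finset I) \ ({i, k} : Finset I)).card = 1 := by
      rw [show (({i, j, k} : Finset I) \ {i, k}) = {j} by ext x; simp; constructor <;> intro h <;> aesop, card_singleton]
    have e3 : (({i, j, k} : Finset I) \ ({i, j} : Finset I)).card = 1 := by
      rw [show (({i, j, k} : Finset I) \ {i, j}) = {k} by ext x; simp; constructor <;> intro h <;> aesop, card_singleton]
    have e4 : (({i, j, k} : Finset I) \ ({i, j, k} : Finset I)).card = 0 := by rw [sdiff_self, bot_eq_empty, card_empty]
    have hins : insert i ({j, k} : Finset I) = {i, j, k} := rfl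
    rw [show insert i ({k} : Finset I) = {i, k} from rfl, show insert i ({j} : Finset I) = {i, j} from rfl, hins, e1, e2, e3, e4]
    ring
  rw [h1, h2, cornerSum_pair F hjk]
  ring

end CornerSum

section Model

variable {α I : Type} [Fintype α] [DecidableEq α] [Fintype I] [DecidableEq I]
  (blk : α → I) (Δ : Matrix α α ℝ) (ℱ : α → ℝ)
variable (adj : I → I → Prop) [DecidableRel adj]
variable (χ : CutoffProfile) {ι υ : Type*} [DecidableEq ι] [DecidableEq υ]
variable (p ek : ℝ) (B : Finset ι) (Φ : ι → (α → ℝ) → ℝ) (c : ι → ℝ) (Ys : Finset υ) (V : υ → (α → ℝ) → ℝ)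
variable (cube : ↥B ⊕ ↥Ys → I)

/-- **THE ACTIVITY OF A MULTI-CUBE POLYMER** (p. 306: `g₁(X) = Σ_Γ ∫ds_Γ ∂_Γ⟨Π f(□_i)⟩_{s_Γ,X}` with `X` a single cluster — for `|X| ≥ 2`
only `Γ = X` qualifies, and only if `X` is connected, p25's `g1_of_two_le`; p. 309: `g₃` = `g₁` with the derivative observables of `H`): the
prime-dropped located activity of `(H, X″)`, `|X″| ≥ 2`, for the data of the region `X` at `(Λ, t, γ)` is `[X″ connected]·Σ_{Λ′⊆X″}(−1)^{|X″∖Λ′|}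
∫ Π dlaw_{1_{Λ′}}`, the integrand being each time the product over the slots located in `X″` of their slot factors differentiated as `H` prescribes
(gen 17's `BIJ88PairActivity309.actIn_pair_eq` is the case `|X″| = 2`). [cite: BalabanImbrieJaffe1988, (5.14.3)–(5.14.4) p.309; p.306 (Sect. 5.13)] -/
theorem actIn_eq_cornerSum (Λ X : Finset I) (t : ℝ) {L : Type*} [DecidableEq L]
    (γ : L → ↥(slotB B Ys cube X) ⊕ ↥(slotY B Ys cube X)) (H : Finset L) {X'' : Finset I} (h2 : 2 ≤ X''.card) :
    actIn blk Δ ℱ adj χ p ek B Φ c Ys V cube Λ X t γ H X'' =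
      if IsConn adj X'' then
        cornerSum (fun Λ' => ∫ ω, ∏ τ ∈ univ.filter (fun τ => cubeIn cube X τ ∈ X''),
            iteratedDeriv ((H.filter fun l => γ l = τ).card)
              (slotFactor χ p ek (slotB B Ys cube X) (fun b ω => Φ b (ext blk X'' ω)) (fun b => c b) (slotY B Ys cube X)
                (fun Y' ω => V Y' (ext blk X'' ω)) ω τ) t
            ∂(regionLaw blk (interpForm blk Δ (corner ℝ Λ)) ℱ X'' Λ')) X''
      else 0 := by
  simp only [actIn]
  rw [prime_of_not _ (fun h => by omega), g3, g1_of_two_le adj _ h2]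
  split_ifs with hc
  · rw [act]
    unfold cornerSum
    refine sum_congr rfl fun Λ' _ => ?_
    rw [zG_eq_integral_regionLaw]
    simp_rw [obs_fD_eq_prod_filter]
  · rfl

end Model

/-! ## §2 The window of the differentiated interaction slot `−Kve^{−Kv}` under a probability law -/

section Bounds

variable {Ω : Type*} [MeasurableSpace Ω]

/-- **the window of `∫ −Kve^{−Kv} dμ`**: for a probability law `μ`, a measurable `0 < v ≤ 1` and `K > 0`:
`−K∫v dμ ≤ ∫ −Kve^{−Kv} dμ ≤ −e^{−K}K∫v dμ` (the one `(d/dt)` of `e^{−tV}` at `t = 1`, `V = Kv`). [cite: BalabanImbrieJaffe1988, (5.14.3) p.309] -/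
theorem integral_neg_mul_exp_neg_window (μ : Measure Ω) [IsProbabilityMeasure μ] {v : Ω → ℝ} (hvm : Measurable v)
    (hv0 : ∀ ω, 0 < v ω) (hv1 : ∀ ω, v ω ≤ 1) {K : ℝ} (hK0 : 0 < K) :
    -(K * ∫ ω, v ω ∂μ) ≤ ∫ ω, -(K * v ω * Real.exp (-(K * v ω))) ∂μ ∧
      ∫ ω, -(K * v ω * Real.exp (-(K * v ω))) ∂μ ≤ -(Real.exp (-K) * (K * ∫ ω, v ω ∂μ)) := by
  have hKv : ∀ ω, 0 ≤ K * v ω ∧ K * v ω ≤ K := fun ω => ⟨by have := hv0 ω; positivity, mul_le_of_le_one_right hK0.le (hv1 ω)⟩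
  have hint : ∀ (g : Ω → ℝ), Measurable g → (∀ ω, |g ω| ≤ K) → Integrable g μ := fun g hg hb =>
    (integrable_const K).mono' hg.aestronglyMeasurable (ae_of_all _ fun ω => by rw [Real.norm_eq_abs]; exact hb ω)
  have hbd : ∀ (a : ℝ) ω, 0 ≤ a → a ≤ 1 → |-(a * (K * v ω))| ≤ K := fun a ω ha ha1 => by
    rw [abs_neg, abs_of_nonneg (mul_nonneg ha (hKv ω).1)]
    exact (mul_le_of_le_one_left (hKv ω).1 ha1).trans (hKv ω).2
  have hm1 : Measurable fun ω => -(K * v ω * Real.exp (-(K * v ω))) :=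
    ((hvm.const_mul K).mul ((hvm.const_mul K).neg.exp)).neg
  have hb1 : ∀ ω, |-(K * v ω * Real.exp (-(K * v ω)))| ≤ K := fun ω => by
    rw [mul_comm (K * v ω)]
    exact hbd _ ω (Real.exp_pos _).le (Real.exp_le_one_iff.2 (by linarith [(hKv ω).1]))
  have hb2 : ∀ ω, |-(K * v ω)| ≤ K := fun ω => by simpa only [one_mul] using hbd 1 ω zero_le_one le_rfl
  have hb3 : ∀ ω, |-(Real.exp (-K) * (K * v ω))| ≤ K := fun ω =>
    hbd _ ω (Real.exp_pos _).le (Real.exp_le_one_iff.2 (by linarith))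
  constructor
  · rw [← integral_const_mul, ← integral_neg]
    refine integral_mono (hint _ (hvm.const_mul K).neg hb2) (hint _ hm1 hb1) fun ω => ?_
    have h1 : Real.exp (-(K * v ω)) ≤ 1 := Real.exp_le_one_iff.2 (by have := hv0 ω; nlinarith)
    have h2 : 0 ≤ K * v ω := (hKv ω).1
    show -(K * v ω) ≤ -(K * v ω * Real.exp (-(K * v ω)))
    nlinarith
  · rw [← integral_const_mul, ← integral_const_mul, ← integral_neg]
    refine integral_mono (hint _ hm1 hb1) (hint _ ((hvm.const_mul K).const_mul _).neg hb3) fun ω => ?_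
    have h1 : Real.exp (-K) ≤ Real.exp (-(K * v ω)) := Real.exp_le_exp.2 (by have := hv1 ω; nlinarith)
    have h2 : 0 ≤ K * v ω := (hKv ω).1
    show -(K * v ω * Real.exp (-(K * v ω))) ≤ -(Real.exp (-K) * (K * v ω))
    nlinarith

end Bounds

/-! ## §3 The datum: three one-site cubes with the CHAIN precision `!![2,1,0;1,2,1;0,1,2]` -/
section Datum3

/-- **the entries of `Δ_{1_Λ}` for one site per cube** (p. 305: *"□_iΔ_s□_{i′} = s_is_{i′}□_iΔ□_{i′}, i′ ≠ i, □_iΔ_s□_i = □_iΔ□_i"*).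
[cite: BalabanImbrieJaffe1988, p.305 (Sect. 5.13)] -/
theorem interpForm_id_corner_apply {n : ℕ} (M : Matrix (Fin n) (Fin n) ℝ) (Λ : Finset (Fin n)) (x y : Fin n) :
    interpForm (id : Fin n → Fin n) M (corner ℝ Λ) x y = if x = y then M x y else if x ∈ Λ ∧ y ∈ Λ then M x y else 0 := by
  rw [interpForm_apply]
  by_cases h : x = y
  · simp [h]
  · simp only [id, if_neg h, corner_apply]
    by_cases hx : x ∈ Λ <;> by_cases hy : y ∈ Λ <;> simp [hx, hy]

/-- at the full corner the interpolated form is the form itself (one site per cube). [cite: BalabanImbrieJaffe1988, p.305 (Sect. 5.13)] -/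
theorem interpForm_id_corner_univ {n : ℕ} (M : Matrix (Fin n) (Fin n) ℝ) :
    interpForm (id : Fin n → Fin n) M (corner ℝ (univ : Finset (Fin n))) = M := by
  ext x y; rw [interpForm_id_corner_apply]; split_ifs <;> simp_all

/-- **the chain precision** `Δ = !![2,1,0;1,2,1;0,1,2]` (cube 0 couples to cube 1, cube 1 to cube 2, NOT cube 0 to cube 2): positive definite with
the form bound `Δ ≥ ½·1` (`φᵀΔφ − ½|φ|² = (3/2)(φ₀ + ⅔φ₁)² + (5/6)(φ₁ + (6/5)φ₂)² + (3/10)φ₂²`). [cite: BalabanImbrieJaffe1988, p.305 (Sect. 5.13)] -/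
theorem chain3_posDef_and_ge :
    (!![2, 1, 0; 1, 2, 1; 0, 1, 2] : Matrix (Fin 3) (Fin 3) ℝ).PosDef ∧
      ∀ φ : Fin 3 → ℝ, (1 / 2) * (φ ⬝ᵥ φ) ≤ φ ⬝ᵥ ((!![2, 1, 0; 1, 2, 1; 0, 1, 2] : Matrix (Fin 3) (Fin 3) ℝ) *ᵥ φ) := by
  have hq : ∀ φ : Fin 3 → ℝ, φ ⬝ᵥ ((!![2, 1, 0; 1, 2, 1; 0, 1, 2] : Matrix (Fin 3) (Fin 3) ℝ) *ᵥ φ) =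
      2 * φ 0 ^ 2 + 2 * φ 1 ^ 2 + 2 * φ 2 ^ 2 + 2 * φ 0 * φ 1 + 2 * φ 1 * φ 2 := fun φ => by
    simp [Matrix.mulVec, dotProduct, Fin.sum_univ_three]; ring
  have hn : ∀ φ : Fin 3 → ℝ, φ ⬝ᵥ φ = φ 0 ^ 2 + φ 1 ^ 2 + φ 2 ^ 2 := fun φ => by simp [dotProduct, Fin.sum_univ_three]; ring
  have hge : ∀ φ : Fin 3 → ℝ, (1 / 2) * (φ ⬝ᵥ φ) ≤ φ ⬝ᵥ ((!![2, 1, 0; 1, 2, 1; 0, 1, 2] : Matrix (Fin 3) (Fin 3) ℝ) *ᵥ φ) := fun φ => by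
    rw [hq, hn]
    nlinarith [sq_nonneg (3 * φ 0 + 2 * φ 1), sq_nonneg (5 * φ 1 + 6 * φ 2), sq_nonneg (φ 2)]
  refine ⟨?_, hge⟩
  rw [Matrix.posDef_iff_dotProduct_mulVec]
  refine ⟨Matrix.IsHermitian.ext fun i j => by fin_cases i <;> fin_cases j <;> simp, fun x hx => ?_⟩
  rw [star_trivial]
  have hpos : 0 < x ⬝ᵥ x := by
    rw [hn]
    have : x 0 ≠ 0 ∨ x 1 ≠ 0 ∨ x 2 ≠ 0 := by
      by_contra h
      push Not at h
      exact hx (by ext i; fin_cases i <;> simp [h.1, h.2.1, h.2.2])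
    rcases this with h | h | h <;> positivity
  linarith [hge x]

/-- transport of the region precisions to `Fin 3`: determinants of `N|_sites` and of `N|_sites + 2E_{00}`. [cite: BalabanImbrieJaffe1988, p.305 (Sect. 5.13)] -/
theorem det_submatrix_univ3 (N : Matrix (Fin 3) (Fin 3) ℝ) :
    (N.submatrix (Subtype.val : BIJ88PolymerRep5134Gauss.Site (id : Fin 3 → Fin 3) (univ : Finset (Fin 3)) → Fin 3) Subtype.val).det = N.det ∧
    (N.submatrix (Subtype.val : BIJ88PolymerRep5134Gauss.Site (id : Fin 3 → Fin 3) (univ : Finset (Fin 3)) → Fin 3) Subtype.val +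
        Matrix.single (⟨0, mem_univ _⟩ : BIJ88PolymerRep5134Gauss.Site (id : Fin 3 → Fin 3) (univ : Finset (Fin 3)))
          (⟨0, mem_univ _⟩ : BIJ88PolymerRep5134Gauss.Site (id : Fin 3 → Fin 3) (univ : Finset (Fin 3))) 2).det =
      (N + Matrix.single 0 0 2).det := by
  have hmem : ∀ z : Fin 3, (id z) ∈ (univ : Finset (Fin 3)) := fun z => mem_univ z
  set e : BIJ88PolymerRep5134Gauss.Site (id : Fin 3 → Fin 3) (univ : Finset (Fin 3)) ≃ Fin 3 := Equiv.subtypeUnivEquiv hmem with he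
  have hval : (Subtype.val : BIJ88PolymerRep5134Gauss.Site (id : Fin 3 → Fin 3) (univ : Finset (Fin 3)) → Fin 3) = e := rfl
  refine ⟨by rw [hval, Matrix.det_submatrix_equiv_self], ?_⟩
  have h0 : (⟨0, mem_univ _⟩ : BIJ88PolymerRep5134Gauss.Site (id : Fin 3 → Fin 3) (univ : Finset (Fin 3))) = e.symm 0 := rfl
  rw [hval, h0, ← Matrix.submatrix_single_equiv e e,
    show N.submatrix e e + (Matrix.single 0 0 (2 : ℝ)).submatrix e e = (N + Matrix.single 0 0 2).submatrix e e from rfl,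
    Matrix.det_submatrix_equiv_self]

/-- `⟨e^{−φ₀²}⟩` under the law of the fields of the three cubes at the corner `1_{Λ′}` of the chain precision:
`√(det Δ_{1_{Λ′}} / det(Δ_{1_{Λ′}} + 2E₀₀))` (gen 17's `integral_exp_neg_sq_div`). [cite: BalabanImbrieJaffe1988, p.306 (Sect. 5.13); (5.14.3) p.309] -/
theorem integral_exp_neg_sq_regionLaw3 (Λ' : Finset (Fin 3)) :
    ∫ ω, Real.exp (-(ω ⟨0, mem_univ _⟩) ^ 2) ∂(regionLaw (id : Fin 3 → Fin 3)
        (!![2, 1, 0; 1, 2, 1; 0, 1, 2] : Matrix (Fin 3) (Fin 3) ℝ) (0 : Fin 3 → ℝ) (univ : Finset (Fin 3)) Λ') =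
      Real.sqrt (interpForm (id : Fin 3 → Fin 3) (!![2, 1, 0; 1, 2, 1; 0, 1, 2] : Matrix (Fin 3) (Fin 3) ℝ) (corner ℝ Λ')).det /
        Real.sqrt (interpForm (id : Fin 3 → Fin 3) (!![2, 1, 0; 1, 2, 1; 0, 1, 2] : Matrix (Fin 3) (Fin 3) ℝ) (corner ℝ Λ') +
          Matrix.single 0 0 2).det := by
  obtain ⟨hΔ, -⟩ := chain3_posDef_and_ge
  have hsrc : ∀ φ : BIJ88PolymerRep5134Gauss.Site (id : Fin 3 → Fin 3) (univ : Finset (Fin 3)) → ℝ,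
      source (src (id : Fin 3 → Fin 3) (0 : Fin 3 → ℝ) (univ : Finset (Fin 3))) φ = 1 := fun φ => by
    simp [source, BIJ88PolymerRep5134Gauss.src]
  have hP := prec_corner_posDef (id : Fin 3 → Fin 3) (!![2, 1, 0; 1, 2, 1; 0, 1, 2] : Matrix (Fin 3) (Fin 3) ℝ) hΔ (univ : Finset (Fin 3)) Λ'
  rw [regionLaw, integral_fieldLaw, prec_interp_corner]
  simp only [hsrc, mul_one]
  rw [integral_exp_neg_sq_div _ hP ⟨0, mem_univ _⟩]
  obtain ⟨h1, h2⟩ := det_submatrix_univ3 (interpForm (id : Fin 3 → Fin 3) (!![2, 1, 0; 1, 2, 1; 0, 1, 2] : Matrix (Fin 3) (Fin 3) ℝ) (corner ℝ Λ'))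
  rw [show prec (id : Fin 3 → Fin 3) (!![2, 1, 0; 1, 2, 1; 0, 1, 2] : Matrix (Fin 3) (Fin 3) ℝ) (univ : Finset (Fin 3)) (corner ℝ Λ') =
      (interpForm (id : Fin 3 → Fin 3) (!![2, 1, 0; 1, 2, 1; 0, 1, 2] : Matrix (Fin 3) (Fin 3) ℝ) (corner ℝ Λ')).submatrix Subtype.val Subtype.val
      from rfl, h1, h2]

/-- **the eight corner forms of the chain come in four coupling patterns**: full chain (`1_{{0,1,2}}`), bond `0–1` only (`1_{{0,1}}`), bond `1–2` only
(`1_{{1,2}}`), no bond (`1_{{0,2}}`, `1_{{0}}`, `1_{{1}}`, `1_{{2}}`, `1_∅` — two non-abutting or fewer than two active cubes activate nothing).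
[cite: BalabanImbrieJaffe1988, p.305 (Sect. 5.13)] -/
theorem interpForm_chain3_corners :
    interpForm (id : Fin 3 → Fin 3) (!![2, 1, 0; 1, 2, 1; 0, 1, 2] : Matrix (Fin 3) (Fin 3) ℝ) (corner ℝ (univ : Finset (Fin 3))) =
        !![2, 1, 0; 1, 2, 1; 0, 1, 2] ∧
      interpForm (id : Fin 3 → Fin 3) (!![2, 1, 0; 1, 2, 1; 0, 1, 2] : Matrix (Fin 3) (Fin 3) ℝ) (corner ℝ ({0, 1} : Finset (Fin 3))) =
        !![2, 1, 0; 1, 2, 0; 0, 0, 2] ∧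
      interpForm (id : Fin 3 → Fin 3) (!![2, 1, 0; 1, 2, 1; 0, 1, 2] : Matrix (Fin 3) (Fin 3) ℝ) (corner ℝ ({1, 2} : Finset (Fin 3))) =
        !![2, 0, 0; 0, 2, 1; 0, 1, 2] ∧
      (∀ Λ' ∈ ({{0, 2}, {0}, {1}, {2}, ∅} : Finset (Finset (Fin 3))),
        interpForm (id : Fin 3 → Fin 3) (!![2, 1, 0; 1, 2, 1; 0, 1, 2] : Matrix (Fin 3) (Fin 3) ℝ) (corner ℝ Λ') = !![2, 0, 0; 0, 2, 0; 0, 0, 2]) := by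
  refine ⟨interpForm_id_corner_univ _, ?_, ?_, ?_⟩
  · ext x y; rw [interpForm_id_corner_apply]; fin_cases x <;> fin_cases y <;> simp
  · ext x y; rw [interpForm_id_corner_apply]; fin_cases x <;> fin_cases y <;> simp
  · intro Λ' hΛ'
    simp only [Finset.mem_insert, Finset.mem_singleton] at hΛ'
    rcases hΛ' with rfl | rfl | rfl | rfl | rfl <;>
      (ext x y; rw [interpForm_id_corner_apply]; fin_cases x <;> fin_cases y <;> simp)

/-- the eight determinants: `4, 10` (full), `6, 14` (bond 0–1), `6, 12` (bond 1–2), `8, 16` (no bond) — site-0 variances `3/4`, `2/3`, `1/2`, `1/2`.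
[cite: BalabanImbrieJaffe1988, p.305 (Sect. 5.13)] -/
theorem chain3_dets :
    (!![2, 1, 0; 1, 2, 1; 0, 1, 2] : Matrix (Fin 3) (Fin 3) ℝ).det = 4 ∧ ((!![2, 1, 0; 1, 2, 1; 0, 1, 2] : Matrix (Fin 3) (Fin 3) ℝ) + Matrix.single 0 0 2).det = 10 ∧
    (!![2, 1, 0; 1, 2, 0; 0, 0, 2] : Matrix (Fin 3) (Fin 3) ℝ).det = 6 ∧ ((!![2, 1, 0; 1, 2, 0; 0, 0, 2] : Matrix (Fin 3) (Fin 3) ℝ) + Matrix.single 0 0 2).det = 14 ∧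
    (!![2, 0, 0; 0, 2, 1; 0, 1, 2] : Matrix (Fin 3) (Fin 3) ℝ).det = 6 ∧ ((!![2, 0, 0; 0, 2, 1; 0, 1, 2] : Matrix (Fin 3) (Fin 3) ℝ) + Matrix.single 0 0 2).det = 12 ∧
    (!![2, 0, 0; 0, 2, 0; 0, 0, 2] : Matrix (Fin 3) (Fin 3) ℝ).det = 8 ∧ ((!![2, 0, 0; 0, 2, 0; 0, 0, 2] : Matrix (Fin 3) (Fin 3) ℝ) + Matrix.single 0 0 2).det = 16 := by
  have e1 : (!![2, 1, 0; 1, 2, 1; 0, 1, 2] : Matrix (Fin 3) (Fin 3) ℝ) + Matrix.single 0 0 2 = !![4, 1, 0; 1, 2, 1; 0, 1, 2] := by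
    ext i j; fin_cases i <;> fin_cases j <;> norm_num [Matrix.single_apply]
  have e2 : (!![2, 1, 0; 1, 2, 0; 0, 0, 2] : Matrix (Fin 3) (Fin 3) ℝ) + Matrix.single 0 0 2 = !![4, 1, 0; 1, 2, 0; 0, 0, 2] := by
    ext i j; fin_cases i <;> fin_cases j <;> norm_num [Matrix.single_apply]
  have e3 : (!![2, 0, 0; 0, 2, 1; 0, 1, 2] : Matrix (Fin 3) (Fin 3) ℝ) + Matrix.single 0 0 2 = !![4, 0, 0; 0, 2, 1; 0, 1, 2] := by
    ext i j; fin_cases i <;> fin_cases j <;> norm_num [Matrix.single_apply]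
  have e4 : (!![2, 0, 0; 0, 2, 0; 0, 0, 2] : Matrix (Fin 3) (Fin 3) ℝ) + Matrix.single 0 0 2 = !![4, 0, 0; 0, 2, 0; 0, 0, 2] := by
    ext i j; fin_cases i <;> fin_cases j <;> norm_num [Matrix.single_apply]
  rw [e1, e2, e3, e4]
  refine ⟨?_, ?_, ?_, ?_, ?_, ?_, ?_, ?_⟩ <;> (rw [Matrix.det_fin_three]; simp; norm_num)

/-- the numerical windows: `√(4/10) ≤ 0.6325`, `0.6546 ≤ √(6/14)`, `0.7071 ≤ √(6/12)`, `0.7071 ≤ √(8/16) ≤ 0.70711`.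
[cite: BalabanImbrieJaffe1988, (5.14.4) p.309] -/
theorem sqrt_windows3 :
    Real.sqrt 4 / Real.sqrt 10 ≤ 6325 / 10000 ∧ (6546 : ℝ) / 10000 ≤ Real.sqrt 6 / Real.sqrt 14 ∧
      (7071 : ℝ) / 10000 ≤ Real.sqrt 6 / Real.sqrt 12 ∧ (7071 : ℝ) / 10000 ≤ Real.sqrt 8 / Real.sqrt 16 ∧
      Real.sqrt 8 / Real.sqrt 16 ≤ 70711 / 100000 := by
  refine ⟨?_, ?_, ?_, ?_, ?_⟩
  · rw [← Real.sqrt_div (by norm_num : (0 : ℝ) ≤ 4)]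
    calc Real.sqrt (4 / 10) ≤ Real.sqrt ((6325 / 10000) ^ 2) := Real.sqrt_le_sqrt (by norm_num)
      _ = 6325 / 10000 := Real.sqrt_sq (by norm_num)
  · rw [← Real.sqrt_div (by norm_num : (0 : ℝ) ≤ 6)]
    calc (6546 : ℝ) / 10000 = Real.sqrt ((6546 / 10000) ^ 2) := (Real.sqrt_sq (by norm_num)).symm
      _ ≤ Real.sqrt (6 / 14) := Real.sqrt_le_sqrt (by norm_num)
  · rw [← Real.sqrt_div (by norm_num : (0 : ℝ) ≤ 6)]
    calc (7071 : ℝ) / 10000 = Real.sqrt ((7071 / 10000) ^ 2) := (Real.sqrt_sq (by norm_num)).symm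
      _ ≤ Real.sqrt (6 / 12) := Real.sqrt_le_sqrt (by norm_num)
  · rw [← Real.sqrt_div (by norm_num : (0 : ℝ) ≤ 8)]
    calc (7071 : ℝ) / 10000 = Real.sqrt ((7071 / 10000) ^ 2) := (Real.sqrt_sq (by norm_num)).symm
      _ ≤ Real.sqrt (8 / 16) := Real.sqrt_le_sqrt (by norm_num)
  · rw [← Real.sqrt_div (by norm_num : (0 : ℝ) ≤ 8)]
    calc Real.sqrt (8 / 16) ≤ Real.sqrt ((70711 / 100000) ^ 2) := Real.sqrt_le_sqrt (by norm_num)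
      _ = 70711 / 100000 := Real.sqrt_sq (by norm_num)

end Datum3


end Literature.MathematicalPhysics.QuantumFieldTheory.BalabanImbrieJaffe1984to88.BIJ88TripleActivity309

end
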